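import Literature.AnabelianGeometry.AbsoluteAnabelian.AbsTopII.DehnTwistLoopInertia
import HarnessLib

/-!
# [AbsTopII] Prop 1.3 (ii) at the NODAL model, stage S3b: the branch pair — `Prop_1_3_ii'` IN FULL, non-idly

S. Mochizuki, *Topics in Absolute Anabelian Geometry II* [AbsTopII] (bib `MochizukiAbsTopII2013`; locators =
PDF pages of the kurims manuscript `paper:url-585b8d0ad0d9`), §1, Prop 1.3 (ii) p. 11: "if `e` is a node that
abuts to vertices `v`, `v′`, then [for appropriate choices of `Π_𝔾`-conjugates] `I_v, I_{v′} ⊆ I_e`, and the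
natural morphism `I_v × I_{v′} → I_e` is an open injective homomorphism, with image of index `i^Σ_e`" — here
at the LOOP (`v = v′`, the two BRANCHES of the node), where the two conjugates are `I_v = 1 ⋊ Ẑ` and its
conjugate by the stable letter `a`: `(a,1)⁻¹ (1,k) (a,1) = (b^{k^i}, k)` (`inl_eta_zero_inv_mul_inr_mul`, S1).

PROOF-ONLY (no definition), abc-iut-L4-t6 lineage, row «DPSC-NODAL-MODEL» stage S3b over S3a
(`DehnTwistLoopInertia.lean`).  In `I_e = b^Ẑ ⋊ Ẑ ≅ Ẑ × Ẑ` (coordinate `ψ = ê_b ∘ left : I_e → Ẑ`, a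
continuous surjective homomorphism because the twist fixes `b^Ẑ`), the subgroup `J` generated by `1 ⋊ Ẑ`
and `{(b^{k^i}, k)}` is `ψ⁻¹(i·Ẑ)` with `i·Ẑ = closure ⟨η(1)^i⟩` the open subgroup of index `i`
(`isOpen_closureZpowersPow` for `Ẑ`; `Ẑ` torsion-free, `ZHatCompletion.eq_one_of_pow_eq_one`, gives
`(1 ⋊ Ẑ) ∩ {(b^{k^i}, k)} = 1`):

* `exists_branchPair` — the branch-pair clause in `Π_I = Ext i`, given `Z_{F̂₂}(b^Ẑ) = b^Ẑ`;
* **`prop_1_3_ii'_dpsc` — the typed `Prop_1_3_ii'` (abc-iut-w5-d102 v2, branch reading) holds at the nodal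
  Dehn-twist datum `dpsc i hi`, ALL THREE CLAUSES, NON-IDLY** (there is a node; `i^Σ_e = i` is attained),
  given the two named centraliser inputs `Z_{F̂₂}(b^Ẑ) = b^Ẑ` ([CombGC] Prop 1.2 (ii)) and `Z_{F̂₂}(Π_v) = 1`.
HONEST FRAMING: classical group theory in a constructed model (constructed ≠ geometric); the two inputs are
hypotheses BY NAME; typed ≠ proved; nothing here bears on [IUTchIII] Cor 3.12.
-/

noncomputable section

open scoped Pointwise

namespace Literature.AnabelianGeometry.AbsoluteAnabelian.AbsTopII.DehnTwist

open Literature.AnabelianGeometry.EtaleTheta.SettingModel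
open Literature.AnabelianGeometry.SemiGraphs
open _root_.Topology

variable (i : ℕ)

/-! ### Small computations in `Π_I = F̂₂ ⋊ Ẑ` -/

/-- `(n, 1) · (1, k)` has left component `n`. [cite: MochizukiAbsTopII2013, Prop 1.3 (ii) p.11] -/
theorem left_inl_mul_inr (n : F₂hatT) (k : ZH) :
    (SemidirectProduct.inl n * SemidirectProduct.inr k : Ext i).left = n := by
  simp only [SemidirectProduct.mul_left, SemidirectProduct.left_inl, SemidirectProduct.right_inl, map_one,
    SemidirectProduct.left_inr, mul_one]

/-- `(n, 1) · (1, k)` has right component `k`. [cite: MochizukiAbsTopII2013, Prop 1.3 (ii) p.11] -/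
theorem right_inl_mul_inr (n : F₂hatT) (k : ZH) :
    (SemidirectProduct.inl n * SemidirectProduct.inr k : Ext i).right = k := by
  simp only [SemidirectProduct.mul_right, SemidirectProduct.right_inl, SemidirectProduct.right_inr, one_mul]

/-- `b^t` centralises `b^Ẑ` (the axis is abelian). [cite: MochizukiAbsTopII2013, Prop 1.3 (ii) p.11] -/
theorem bPow_mem_centralizer_nodeGp (t : ZH) : bPow t ∈ Subgroup.centralizer (nodeGp : Set F₂hatT) := by
  rw [Subgroup.mem_centralizer_iff]
  rintro _ ⟨s, rfl⟩
  change bPow s * bPow t = bPow t * bPow s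
  rw [← map_mul, ← map_mul, Literature.AnabelianGeometry.AbsoluteAnabelian.ZHatCompletion.mul_comm]

/-- `(b^t, 1) · (1, k) ∈ I_e = Z_{Π_I}(Π_e × 1)`. [cite: MochizukiAbsTopII2013, Prop 1.3 (ii) p.11] -/
theorem inl_bPow_mul_inr_mem (t k : ZH) :
    (SemidirectProduct.inl (bPow t) * SemidirectProduct.inr k : Ext i) ∈
      Subgroup.centralizer ((nodeGp.map (SemidirectProduct.inl : F₂hatT →* Ext i) : Subgroup (Ext i)) :
        Set (Ext i)) ⊓ (⊤ : Subgroup (Ext i)) := by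
  refine Subgroup.mul_mem _ ?_ (range_inr_le_centralizer i ⟨k, rfl⟩)
  rw [mem_centralizer_node_inf_top_iff, SemidirectProduct.left_inl]
  exact bPow_mem_centralizer_nodeGp t

/-- The conjugate of `I_v = 1 ⋊ Ẑ` by the stable letter: `x ∈ (a,1)⁻¹ · (1 ⋊ Ẑ) · (a,1)` iff
`x = (b^{k^i}, k)` for some `k`. [cite: MochizukiAbsTopII2013, Prop 1.3 (ii) p.11] -/
theorem mem_conjInv_smul_range_inr_iff (x : Ext i) :
    x ∈ MulAut.conj (SemidirectProduct.inl (eta (FreeGroup.of 0)) : Ext i)⁻¹ •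
        (SemidirectProduct.inr : ZH →* Ext i).range ↔
      ∃ k : ZH, SemidirectProduct.inl (bPow (k ^ i)) * SemidirectProduct.inr k = x := by
  rw [Subgroup.mem_smul_pointwise_iff_exists]
  constructor
  · rintro ⟨_, ⟨k, rfl⟩, rfl⟩
    exact ⟨k, by rw [MulAut.smul_def, MulAut.conj_apply, inv_inv, inl_eta_zero_inv_mul_inr_mul]⟩
  · rintro ⟨k, rfl⟩
    exact ⟨SemidirectProduct.inr k, ⟨k, rfl⟩, by
      rw [MulAut.smul_def, MulAut.conj_apply, inv_inv, inl_eta_zero_inv_mul_inr_mul]⟩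

/-- `(1, k)` commutes with `(b^t, 1) · (1, k')` (the twist fixes `b^Ẑ`; `Ẑ` is abelian).
[cite: MochizukiAbsTopII2013, Prop 1.3 (ii) p.11] -/
theorem inr_mul_inl_bPow_mul_inr_comm (k t k' : ZH) :
    (SemidirectProduct.inr k : Ext i) * (SemidirectProduct.inl (bPow t) * SemidirectProduct.inr k') =
      SemidirectProduct.inl (bPow t) * SemidirectProduct.inr k' * SemidirectProduct.inr k := by
  have h1 : (SemidirectProduct.inl (bPow t) : Ext i) * SemidirectProduct.inr k =
      SemidirectProduct.inr k * SemidirectProduct.inl (bPow t) :=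
    Subgroup.mem_centralizer_iff.mp (range_inr_le_centralizer i ⟨k, rfl⟩).1 _ ⟨bPow t, ⟨t, rfl⟩, rfl⟩
  have h2 : (SemidirectProduct.inr k : Ext i) * SemidirectProduct.inr k' =
      SemidirectProduct.inr k' * SemidirectProduct.inr k := by
    rw [← map_mul, ← map_mul, Literature.AnabelianGeometry.AbsoluteAnabelian.ZHatCompletion.mul_comm]
  rw [← mul_assoc, ← h1, mul_assoc, h2, ← mul_assoc]

/-! ### The branch pair in `Π_I = Ext i` -/

/-- **The branch-pair clause of Prop 1.3 (ii) at the loop, in `Π_I`**, given `Z_{F̂₂}(b^Ẑ) = b^Ẑ`: with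
`I := 1 ⋊ Ẑ` and its conjugate `I′ := (a,1)⁻¹ I (a,1) = {(b^{k^i}, k)}` by the stable letter, the subgroup
`J := I · I′` is an internal direct product `I × I′`, lies in `I_e`, is open there, and has index `i`.
[cite: MochizukiAbsTopII2013, Prop 1.3 (ii) p.11] -/
theorem exists_branchPair (hi : 0 < i) (hZb : Subgroup.centralizer (nodeGp : Set F₂hatT) = nodeGp) :
    ∃ J : Subgroup (Ext i),
      IsInternalProduct (MulAut.conj (1 : Ext i) • (SemidirectProduct.inr : ZH →* Ext i).range)
        (MulAut.conj (SemidirectProduct.inl (eta (FreeGroup.of 0)) : Ext i)⁻¹ •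
          (SemidirectProduct.inr : ZH →* Ext i).range) J ∧
      J ≤ Subgroup.centralizer ((nodeGp.map (SemidirectProduct.inl : F₂hatT →* Ext i) : Subgroup (Ext i)) :
          Set (Ext i)) ⊓ (⊤ : Subgroup (Ext i)) ∧
      IsOpen ((J.subgroupOf (Subgroup.centralizer ((nodeGp.map (SemidirectProduct.inl : F₂hatT →* Ext i) :
          Subgroup (Ext i)) : Set (Ext i)) ⊓ (⊤ : Subgroup (Ext i))) : Subgroup
            ↥(Subgroup.centralizer ((nodeGp.map (SemidirectProduct.inl : F₂hatT →* Ext i) :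
              Subgroup (Ext i)) : Set (Ext i)) ⊓ (⊤ : Subgroup (Ext i)))) :
        Set ↥(Subgroup.centralizer ((nodeGp.map (SemidirectProduct.inl : F₂hatT →* Ext i) :
          Subgroup (Ext i)) : Set (Ext i)) ⊓ (⊤ : Subgroup (Ext i)))) ∧
      J.relIndex (Subgroup.centralizer ((nodeGp.map (SemidirectProduct.inl : F₂hatT →* Ext i) :
          Subgroup (Ext i)) : Set (Ext i)) ⊓ (⊤ : Subgroup (Ext i))) = i := by
  -- the open subgroup `i·Ẑ = closure ⟨η1^i⟩` of index `i` in `Ẑ`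
  obtain ⟨η1, hη1⟩ : ∃ η1 : ZH, Dense ((Subgroup.zpowers η1 : Subgroup ZH) : Set ZH) :=
    ⟨_, ZHatCompletion.dense_zpowers_eta_one⟩
  obtain ⟨hPopen, hPidx⟩ :=
    isOpen_closureZpowersPow hη1 hi (ZHatCompletion.exists_isOpen_index hi)
  have hPcl : IsClosed (((Subgroup.zpowers (η1 ^ i)).topologicalClosure : Subgroup ZH) : Set ZH) :=
    Subgroup.isClosed_of_isOpen _ hPopen
  have hgen : ∀ m : ℤ, (η1 ^ m) ^ i = (η1 ^ i) ^ m := fun m => by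
    rw [← zpow_natCast, ← zpow_mul, ← zpow_natCast, ← zpow_mul, mul_comm]
  -- (P1) every `i`-th power lies in `i·Ẑ`
  have hP1 : ∀ k : ZH, k ^ i ∈ (Subgroup.zpowers (η1 ^ i)).topologicalClosure := by
    have hsub : (Set.univ : Set ZH) ⊆
        (fun k : ZH => k ^ i) ⁻¹' (((Subgroup.zpowers (η1 ^ i)).topologicalClosure : Subgroup ZH) : Set ZH) := by
      rw [← hη1.closure_eq]
      refine closure_minimal ?_ (hPcl.preimage (continuous_pow i))
      intro x hx
      obtain ⟨m, rfl⟩ := Subgroup.mem_zpowers_iff.mp hx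
      show (η1 ^ m) ^ i ∈ (Subgroup.zpowers (η1 ^ i)).topologicalClosure
      rw [hgen m]
      exact Subgroup.le_topologicalClosure _ (Subgroup.zpow_mem_zpowers _ m)
    exact fun k => hsub (Set.mem_univ k)
  -- (P2) `i·Ẑ` consists of `i`-th powers (the `i`-th powers form a compact, hence closed, set)
  have hP2 : ∀ x ∈ (Subgroup.zpowers (η1 ^ i)).topologicalClosure, ∃ k : ZH, k ^ i = x := by
    have hsub : (((Subgroup.zpowers (η1 ^ i)).topologicalClosure : Subgroup ZH) : Set ZH) ⊆
        Set.range (fun k : ZH => k ^ i) := by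
      rw [Subgroup.topologicalClosure_coe]
      refine closure_minimal ?_ (isCompact_range (continuous_pow i)).isClosed
      intro x hx
      obtain ⟨m, rfl⟩ := Subgroup.mem_zpowers_iff.mp hx
      exact ⟨η1 ^ m, hgen m⟩
    exact fun x hx => hsub hx
  -- elements of `I_e` have left component in `b^Ẑ`
  have hleft : ∀ g : Ext i,
      g ∈ Subgroup.centralizer ((nodeGp.map (SemidirectProduct.inl : F₂hatT →* Ext i) : Subgroup (Ext i)) :
          Set (Ext i)) ⊓ (⊤ : Subgroup (Ext i)) → g.left ∈ (bAxis : Subgroup F₂hatT) := fun g hg => by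
    have h := (mem_centralizer_node_inf_top_iff i g).mp hg
    rw [hZb] at h
    exact h
  -- the coordinate `ψ = ê_b ∘ left : I_e →* Ẑ` (a homomorphism because the twist fixes `b^Ẑ`)
  let ψ : ↥(Subgroup.centralizer ((nodeGp.map (SemidirectProduct.inl : F₂hatT →* Ext i) : Subgroup (Ext i)) :
      Set (Ext i)) ⊓ (⊤ : Subgroup (Ext i))) →* ZH :=
    { toFun := fun g => eHatB g.1.left
      map_one' := by
        show eHatB ((1 : Ext i).left) = 1
        rw [SemidirectProduct.one_left, map_one]
      map_mul' := fun g h => by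
        show eHatB ((g.1 * h.1).left) = eHatB g.1.left * eHatB h.1.left
        rw [SemidirectProduct.mul_left, shearPow_mem_nodeGp i g.1.right h.1.left (hleft h.1 h.2), map_mul] }
  have hψc : Continuous ψ :=
    eHatB.continuous.comp ((Semidirect.continuous_left (isInducing_leftRight i)).comp continuous_subtype_val)
  have hψs : Function.Surjective ψ := fun t =>
    ⟨⟨SemidirectProduct.inl (bPow t), map_inl_node_le_centralizer i hZb ⟨bPow t, ⟨t, rfl⟩, rfl⟩⟩, eHatB_bPow t⟩
  -- membership of the second branch's elements
  have hBmem : ∀ k : ZH, (SemidirectProduct.inl (bPow (k ^ i)) * SemidirectProduct.inr k : Ext i) ∈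
      MulAut.conj (SemidirectProduct.inl (eta (FreeGroup.of 0)) : Ext i)⁻¹ •
        (SemidirectProduct.inr : ZH →* Ext i).range :=
    fun k => (mem_conjInv_smul_range_inr_iff i _).mpr ⟨k, rfl⟩
  -- `J := ψ⁻¹(i·Ẑ)`
  have hAJ : (SemidirectProduct.inr : ZH →* Ext i).range ≤
      (((Subgroup.zpowers (η1 ^ i)).topologicalClosure).comap ψ).map (Subgroup.subtype _) := by
    rintro _ ⟨k, rfl⟩
    refine ⟨⟨SemidirectProduct.inr k, range_inr_le_centralizer i ⟨k, rfl⟩⟩, ?_, rfl⟩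
    show eHatB ((SemidirectProduct.inr k : Ext i).left) ∈ (Subgroup.zpowers (η1 ^ i)).topologicalClosure
    rw [SemidirectProduct.left_inr, map_one]
    exact Subgroup.one_mem _
  have hBJ : MulAut.conj (SemidirectProduct.inl (eta (FreeGroup.of 0)) : Ext i)⁻¹ •
        (SemidirectProduct.inr : ZH →* Ext i).range ≤
      (((Subgroup.zpowers (η1 ^ i)).topologicalClosure).comap ψ).map (Subgroup.subtype _) := by
    intro x hx
    obtain ⟨k, rfl⟩ := (mem_conjInv_smul_range_inr_iff i x).mp hx
    refine ⟨⟨_, inl_bPow_mul_inr_mem i (k ^ i) k⟩, ?_, rfl⟩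
    show eHatB ((SemidirectProduct.inl (bPow (k ^ i)) * SemidirectProduct.inr k : Ext i).left) ∈
      (Subgroup.zpowers (η1 ^ i)).topologicalClosure
    rw [left_inl_mul_inr, eHatB_bPow]
    exact hP1 k
  have hJ : ((((Subgroup.zpowers (η1 ^ i)).topologicalClosure).comap ψ).map (Subgroup.subtype _)).subgroupOf
      (Subgroup.centralizer ((nodeGp.map (SemidirectProduct.inl : F₂hatT →* Ext i) : Subgroup (Ext i)) :
        Set (Ext i)) ⊓ (⊤ : Subgroup (Ext i))) =
      ((Subgroup.zpowers (η1 ^ i)).topologicalClosure).comap ψ :=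
    Subgroup.comap_map_eq_self_of_injective (Subgroup.subtype_injective _) _
  refine ⟨(((Subgroup.zpowers (η1 ^ i)).topologicalClosure).comap ψ).map (Subgroup.subtype _), ?_,
    Subgroup.map_subtype_le _, ?_, ?_⟩
  · -- internal direct product `I × I′ ⥲ J`
    rw [map_one, one_smul]
    refine ⟨hAJ, hBJ, ?_, ?_, ?_⟩
    · rintro _ ⟨k, rfl⟩ x hx
      obtain ⟨k', rfl⟩ := (mem_conjInv_smul_range_inr_iff i x).mp hx
      exact inr_mul_inl_bPow_mul_inr_comm i k (k' ^ i) k'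
    · rw [eq_bot_iff]
      rintro x ⟨⟨k, rfl⟩, hx⟩
      obtain ⟨k', hk'⟩ := (mem_conjInv_smul_range_inr_iff i _).mp hx
      have hr : k' = k := by
        have h := congrArg SemidirectProduct.right hk'
        rwa [right_inl_mul_inr, SemidirectProduct.right_inr] at h
      have hl : bPow (k' ^ i) = 1 := by
        have h := congrArg SemidirectProduct.left hk'
        rwa [left_inl_mul_inr, SemidirectProduct.left_inr] at h
      have hk1 : k' ^ i = 1 := bPow_injective (by rw [hl, map_one])
      have hk : k = 1 := by
        rw [← hr]
        exact ZHatCompletion.eq_one_of_pow_eq_one hi.ne' hk1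
      rw [hk, map_one]
      exact Subgroup.one_mem _
    · apply le_antisymm (sup_le hAJ hBJ)
      rintro _ ⟨y, hy, rfl⟩
      obtain ⟨k', hk'⟩ := hP2 _ hy
      obtain ⟨t, ht⟩ := hleft y.1 y.2
      have hty : bPow t = y.1.left := ht
      have hk'' : k' ^ i = eHatB y.1.left := hk'
      have htk : t = k' ^ i := by
        rw [hk'', ← hty, eHatB_bPow]
      have hy1 : (y : Ext i) = SemidirectProduct.inl (bPow (k' ^ i)) * SemidirectProduct.inr k' *
          SemidirectProduct.inr (k'⁻¹ * y.1.right) := by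
        rw [mul_assoc, ← map_mul, mul_inv_cancel_left, ← htk, hty, SemidirectProduct.inl_left_mul_inr_right]
      show (y : Ext i) ∈ _
      rw [hy1]
      exact Subgroup.mul_mem _ (Subgroup.mem_sup_right (hBmem k')) (Subgroup.mem_sup_left ⟨_, rfl⟩)
  · -- `J` is open in `I_e`
    rw [hJ]
    exact hPopen.preimage hψc
  · -- `[I_e : J] = [Ẑ : i·Ẑ] = i`
    rw [Subgroup.relIndex, hJ, Subgroup.index_comap_of_surjective _ hψs]
    exact hPidx

/-! ### `Prop_1_3_ii'` at the nodal model, in full -/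

section Dpsc

variable {i} (hi : 0 < i)

/-- **[AbsTopII] Prop 1.3 (ii) — the typed `Prop_1_3_ii'` (v2, branch reading) — holds at the NODAL Dehn-twist
datum `dpsc i hi`, ALL THREE CLAUSES, NON-IDLY** (there is a node; the two branches `I_v = 1 ⋊ Ẑ` and
`(a,1)⁻¹ I_v (a,1)` generate an open subgroup of `I_e ≅ Ẑ × Ẑ` of index exactly `i^Σ_e = i`), given the
named centraliser inputs `Z_{F̂₂}(b^Ẑ) = b^Ẑ` and `Z_{F̂₂}(Π_v) = 1`. [cite: MochizukiAbsTopII2013, Prop 1.3 (ii) p.11] -/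
theorem prop_1_3_ii'_dpsc (hZb : Subgroup.centralizer (nodeGp : Set F₂hatT) = nodeGp)
    (hZv : Subgroup.centralizer (vertGp : Set F₂hatT) = ⊥) :
    Literature.AnabelianGeometry.AbsoluteAnabelian.AbsTopII.DPSCIndexData.Prop_1_3_ii' (dpsc i hi) := by
  intro e
  refine ⟨prop_1_3_ii_clause1_dpsc hi hZb e, prop_1_3_ii_clause2_dpsc hi hZb e, ?_⟩
  intro v v' _ _ _
  refine ⟨1, (SemidirectProduct.inl (eta (FreeGroup.of 0)) : Ext i)⁻¹, Subgroup.one_mem _,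
    Subgroup.inv_mem _ ⟨eta (FreeGroup.of 0), rfl⟩, ?_⟩
  rw [Iv_dpsc_eq_range_inr hi hZv v, Iv_dpsc_eq_range_inr hi hZv v']
  exact exists_branchPair i hi hZb

end Dpsc

/-- Hence a DPSC datum WITH A NODE at which the typed `Prop_1_3_ii'` holds non-idly exists (given the two
named inputs). [cite: MochizukiAbsTopII2013, Prop 1.3 (ii) p.11] -/
theorem exists_nodal_model_prop_1_3_ii' (hi : 0 < i)
    (hZb : Subgroup.centralizer (nodeGp : Set F₂hatT) = nodeGp)
    (hZv : Subgroup.centralizer (vertGp : Set F₂hatT) = ⊥) :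
    ∃ X : DPSCIndexData.{0}, Nonempty X.Node ∧ X.Sigma = {p | p.Prime} ∧ (∀ e : X.Node, X.sigmaIndex e = i) ∧
      Literature.AnabelianGeometry.AbsoluteAnabelian.AbsTopII.DPSCIndexData.Prop_1_3_ii' X :=
  ⟨dpsc i hi, dpsc_node_nonempty i hi, rfl, fun _ => rfl, prop_1_3_ii'_dpsc hi hZb hZv⟩

end Literature.AnabelianGeometry.AbsoluteAnabelian.AbsTopII.DehnTwist

end
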